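import Mathlib.MeasureTheory.Measure.Lebesgue.EqHaar
import Mathlib.MeasureTheory.Measure.Haar.OfBasis
import Mathlib.MeasureTheory.Constructions.Pi
import Mathlib.MeasureTheory.Measure.Prod
import HarnessLib

/-!
# The cone substitution on `ℝ³` (no polar coordinates): `∫_{K_i} H = ∫_v ∫_a H(a/λ, (a/λ)v)·a²/λ³`

Sub-problem `SwapVirialDeficit`, crux ⟨stmt-QuantumFields-24197⟩ `SwapGluedStiffness`, skeleton ➎, stub `stub_core_tip`, socket (hCore); file F2 of w2 g61's
aligned-rotation assembly (HOME memo `w2-g61-memo-hCore-S3S4-aligned.md` §2, LEAD g100 ruling (B8)).  The three coordinate CONES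
`K_i = {Σ_{j≠i} x_j² ≤ 2x_i²}` cover `ℝ³`; on the cone `K = {|x⊥|² ≤ 2x₀²} ⊆ ℝ × ℝ²` the letters `v = x⊥/x₀ ∈ ℝ²` (`|v|² ≤ 2`) and the SIGNED radius
`a = x₀·√(1+|v|²)` turn `d³x` into `a²(1+|v|²)^{−3/2} da dv` — two one-parameter scalings inside Tonelli:
* `lintegral_cone_slice` — at fixed `x₀ ≠ 0`: `∫⁻ 𝟙_{|w|²≤2x₀²} G(w) dw = x₀²·∫⁻ 𝟙_{|v|²≤2} G(x₀•v) dv` (✓`Measure.map_addHaar_smul` on `ℝ²`);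
* `lintegral_real_rescale` — `∫⁻ g = c⁻¹·∫⁻ a, g(c⁻¹a)` for `0 < c` (✓`Real.map_volume_mul_left`);
* ★★ `lintegral_cone_subst` — `∫⁻ 𝟙_K·H = ∫⁻_{|v|²≤2} ∫⁻_a H(a/λ, (a/λ)•v)·ofReal(a²/λ³) da dv`, `λ = √(1+|v|²)`, for measurable `H ≥ 0` on `ℝ × (Fin 2 → ℝ)`;
* `cones_cover`, ★ `lintegral_le_cones` — `∫⁻_{ℝ³} H ≤ Σ_i ∫⁻ 𝟙_{K_i} H` on `Fin 3 → ℝ`;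
* ★ `lintegral_cone_transfer` — `∫⁻_{Fin 3 → ℝ} 𝟙_{K_i}·H = ∫⁻_{ℝ×ℝ²} 𝟙_K(x)·H(e_i⁻¹ x)` with `e_i = MeasurableEquiv.piFinSuccAbove _ i` (✓`volume_preserving_piFinSuccAbove`);
* ★★ `lintegral_le_cones_transfer` — the chain: `∫⁻_{ℝ³} H ≤ Σ_i ∫⁻_{ℝ×ℝ²} 𝟙_K·(H ∘ e_i⁻¹)`.

HONEST LABEL: measure bookkeeping only (Mathlib-only file); (hCore), `stub_core_tip`, ⟨24197⟩, ⟨24194⟩ remain OPEN; nothing here proves the Yang–Mills mass gap.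
-/

noncomputable section

open MeasureTheory Set Module
open scoped BigOperators ENNReal

namespace Summit.QuantumFields.YangMills.Theorems.SwapVirialDeficit.SectorLaplace

/-! ## §1 The two scalings -/

/-- At fixed `x₀ ≠ 0`: `∫⁻ 𝟙_{|w|² ≤ 2x₀²} G = x₀² · ∫⁻ 𝟙_{|v|² ≤ 2} G(x₀ • v)` on `ℝ²` (the substitution `w = x₀ • v`). [folklore] -/
theorem lintegral_cone_slice {G : (Fin 2 → ℝ) → ℝ≥0∞} (hG : Measurable G) {x₀ : ℝ} (hx : x₀ ≠ 0) :
    ∫⁻ w : Fin 2 → ℝ, {w : Fin 2 → ℝ | w 0 ^ 2 + w 1 ^ 2 ≤ 2 * x₀ ^ 2}.indicator G w =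
      ENNReal.ofReal (x₀ ^ 2) * ∫⁻ v : Fin 2 → ℝ, {v : Fin 2 → ℝ | v 0 ^ 2 + v 1 ^ 2 ≤ 2}.indicator (fun v => G (x₀ • v)) v := by
  have hK : MeasurableSet {w : Fin 2 → ℝ | w 0 ^ 2 + w 1 ^ 2 ≤ 2 * x₀ ^ 2} :=
    measurableSet_le (((measurable_pi_apply 0).pow_const 2).add ((measurable_pi_apply 1).pow_const 2)) measurable_const
  have hmap := Measure.map_addHaar_smul (volume : Measure (Fin 2 → ℝ)) hx
  have hd : finrank ℝ (Fin 2 → ℝ) = 2 := by simp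
  rw [hd] at hmap
  -- `∫⁻ v, g (x₀ • v) = ofReal |(x₀²)⁻¹| * ∫⁻ g`
  have hcomp : ∫⁻ v : Fin 2 → ℝ, {w : Fin 2 → ℝ | w 0 ^ 2 + w 1 ^ 2 ≤ 2 * x₀ ^ 2}.indicator G (x₀ • v) =
      ENNReal.ofReal |(x₀ ^ 2)⁻¹| * ∫⁻ w : Fin 2 → ℝ, {w : Fin 2 → ℝ | w 0 ^ 2 + w 1 ^ 2 ≤ 2 * x₀ ^ 2}.indicator G w := by
    rw [← lintegral_map (hG.indicator hK) (measurable_const_smul x₀), hmap, lintegral_smul_measure, smul_eq_mul]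
  -- the indicator transforms: `x₀ • v ∈ K ↔ v ∈ D`
  have hind : ∀ v : Fin 2 → ℝ, {w : Fin 2 → ℝ | w 0 ^ 2 + w 1 ^ 2 ≤ 2 * x₀ ^ 2}.indicator G (x₀ • v) =
      {v : Fin 2 → ℝ | v 0 ^ 2 + v 1 ^ 2 ≤ 2}.indicator (fun v => G (x₀ • v)) v := fun v => by
    have hx2 : 0 < x₀ ^ 2 := by positivity
    by_cases hv : v 0 ^ 2 + v 1 ^ 2 ≤ 2
    · have hw : x₀ • v ∈ {w : Fin 2 → ℝ | w 0 ^ 2 + w 1 ^ 2 ≤ 2 * x₀ ^ 2} := by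
        show (x₀ • v) 0 ^ 2 + (x₀ • v) 1 ^ 2 ≤ 2 * x₀ ^ 2
        simp only [Pi.smul_apply, smul_eq_mul]; nlinarith
      rw [Set.indicator_of_mem hw, Set.indicator_of_mem (show v ∈ {v : Fin 2 → ℝ | v 0 ^ 2 + v 1 ^ 2 ≤ 2} from hv)]
    · have hw : x₀ • v ∉ {w : Fin 2 → ℝ | w 0 ^ 2 + w 1 ^ 2 ≤ 2 * x₀ ^ 2} := fun h => by
        have h' : (x₀ • v) 0 ^ 2 + (x₀ • v) 1 ^ 2 ≤ 2 * x₀ ^ 2 := h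
        simp only [Pi.smul_apply, smul_eq_mul] at h'
        exact hv (by nlinarith)
      rw [Set.indicator_of_notMem hw, Set.indicator_of_notMem (show v ∉ {v : Fin 2 → ℝ | v 0 ^ 2 + v 1 ^ 2 ≤ 2} from hv)]
  simp_rw [hind] at hcomp
  rw [hcomp, ← mul_assoc, ← ENNReal.ofReal_mul (by positivity), abs_of_pos (by positivity), mul_inv_cancel₀ (by positivity),
    ENNReal.ofReal_one, one_mul]

/-- `∫⁻ g = c⁻¹ · ∫⁻ a, g(c⁻¹·a)` on `ℝ` for `0 < c` (the substitution `x = a/c`). [folklore] -/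
theorem lintegral_real_rescale {g : ℝ → ℝ≥0∞} (hg : Measurable g) {c : ℝ} (hc : 0 < c) :
    ∫⁻ x : ℝ, g x = ENNReal.ofReal c⁻¹ * ∫⁻ a : ℝ, g (c⁻¹ * a) := by
  have hmap := Real.map_volume_mul_left (inv_ne_zero hc.ne')
  rw [inv_inv, abs_of_pos hc] at hmap
  rw [← lintegral_map hg (measurable_const_mul c⁻¹), hmap, lintegral_smul_measure, smul_eq_mul, ← mul_assoc,
    ← ENNReal.ofReal_mul (by positivity), inv_mul_cancel₀ hc.ne', ENNReal.ofReal_one, one_mul]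

/-! ## §2 The cone substitution on `ℝ × ℝ²` -/

/-- ★★ **THE CONE SUBSTITUTION**: for measurable `H ≥ 0` on `ℝ × ℝ²`, with `λ(v) = √(1+|v|²)`,
`∫⁻ 𝟙_{|x⊥|² ≤ 2x₀²}·H = ∫⁻_{|v|² ≤ 2} ∫⁻_a H(a/λ, (a/λ)•v)·(a²/λ³) da dv`. [folklore] -/
theorem lintegral_cone_subst {H : ℝ × (Fin 2 → ℝ) → ℝ≥0∞} (hH : Measurable H) :
    ∫⁻ x : ℝ × (Fin 2 → ℝ), {x : ℝ × (Fin 2 → ℝ) | x.2 0 ^ 2 + x.2 1 ^ 2 ≤ 2 * x.1 ^ 2}.indicator H x =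
      ∫⁻ v : Fin 2 → ℝ, {v : Fin 2 → ℝ | v 0 ^ 2 + v 1 ^ 2 ≤ 2}.indicator
        (fun v => ∫⁻ a : ℝ, H ((Real.sqrt (1 + (v 0 ^ 2 + v 1 ^ 2)))⁻¹ * a, ((Real.sqrt (1 + (v 0 ^ 2 + v 1 ^ 2)))⁻¹ * a) • v) *
          ENNReal.ofReal (a ^ 2 / Real.sqrt (1 + (v 0 ^ 2 + v 1 ^ 2)) ^ 3)) v := by
  have hK : MeasurableSet {x : ℝ × (Fin 2 → ℝ) | x.2 0 ^ 2 + x.2 1 ^ 2 ≤ 2 * x.1 ^ 2} :=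
    measurableSet_le ((((measurable_pi_apply 0).comp measurable_snd).pow_const 2).add (((measurable_pi_apply 1).comp measurable_snd).pow_const 2))
      ((measurable_fst.pow_const 2).const_mul 2)
  have hD : MeasurableSet {v : Fin 2 → ℝ | v 0 ^ 2 + v 1 ^ 2 ≤ 2} :=
    measurableSet_le (((measurable_pi_apply 0).pow_const 2).add ((measurable_pi_apply 1).pow_const 2)) measurable_const
  -- (1) Tonelli: `x = (x₀, x⊥)`
  rw [show (volume : Measure (ℝ × (Fin 2 → ℝ))) = (volume : Measure ℝ).prod volume from rfl,
    lintegral_prod _ ((hH.indicator hK).aemeasurable)]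
  -- (2) the slice at `x₀ ≠ 0`
  have hsm : Measurable fun q : ℝ × (Fin 2 → ℝ) => (q.1, q.1 • q.2) := measurable_fst.prodMk (measurable_fst.smul measurable_snd)
  have hslice : ∀ x₀ : ℝ, x₀ ≠ 0 →
      ∫⁻ w : Fin 2 → ℝ, {x : ℝ × (Fin 2 → ℝ) | x.2 0 ^ 2 + x.2 1 ^ 2 ≤ 2 * x.1 ^ 2}.indicator H (x₀, w) =
        ∫⁻ v : Fin 2 → ℝ, ENNReal.ofReal (x₀ ^ 2) * {v : Fin 2 → ℝ | v 0 ^ 2 + v 1 ^ 2 ≤ 2}.indicator (fun v => H (x₀, x₀ • v)) v := by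
    intro x₀ hx
    have hG : Measurable fun w : Fin 2 → ℝ => H (x₀, w) := hH.comp (measurable_const.prodMk measurable_id)
    have e : ∀ w : Fin 2 → ℝ, {x : ℝ × (Fin 2 → ℝ) | x.2 0 ^ 2 + x.2 1 ^ 2 ≤ 2 * x.1 ^ 2}.indicator H (x₀, w) =
        {w : Fin 2 → ℝ | w 0 ^ 2 + w 1 ^ 2 ≤ 2 * x₀ ^ 2}.indicator (fun w => H (x₀, w)) w := fun w => by
      by_cases hw : w 0 ^ 2 + w 1 ^ 2 ≤ 2 * x₀ ^ 2
      · rw [Set.indicator_of_mem (show (x₀, w) ∈ {x : ℝ × (Fin 2 → ℝ) | x.2 0 ^ 2 + x.2 1 ^ 2 ≤ 2 * x.1 ^ 2} from hw),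
          Set.indicator_of_mem (show w ∈ {w : Fin 2 → ℝ | w 0 ^ 2 + w 1 ^ 2 ≤ 2 * x₀ ^ 2} from hw)]
      · rw [Set.indicator_of_notMem (show (x₀, w) ∉ {x : ℝ × (Fin 2 → ℝ) | x.2 0 ^ 2 + x.2 1 ^ 2 ≤ 2 * x.1 ^ 2} from hw),
          Set.indicator_of_notMem (show w ∉ {w : Fin 2 → ℝ | w 0 ^ 2 + w 1 ^ 2 ≤ 2 * x₀ ^ 2} from hw)]
    simp_rw [e]
    rw [lintegral_cone_slice hG hx, lintegral_const_mul]
    exact (hG.comp (measurable_const_smul x₀)).indicator hD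
  have hae : ∀ᵐ x₀ : ℝ, x₀ ≠ 0 := by
    rw [ae_iff]
    simp only [ne_eq, not_not, setOf_eq_eq_singleton, measure_singleton]
  rw [lintegral_congr_ae (hae.mono fun x₀ hx => hslice x₀ hx)]
  -- (3) swap the order
  have hF : Measurable fun q : ℝ × (Fin 2 → ℝ) => ENNReal.ofReal (q.1 ^ 2) * {v : Fin 2 → ℝ | v 0 ^ 2 + v 1 ^ 2 ≤ 2}.indicator (fun v => H (q.1, q.1 • v)) q.2 := by
    refine (ENNReal.measurable_ofReal.comp (measurable_fst.pow_const 2)).mul ?_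
    have h1 : Measurable fun q : ℝ × (Fin 2 → ℝ) => H (q.1, q.1 • q.2) := hH.comp hsm
    have h2 : Measurable fun q : ℝ × (Fin 2 → ℝ) => ({v : Fin 2 → ℝ | v 0 ^ 2 + v 1 ^ 2 ≤ 2}.indicator (fun _ => (1 : ℝ≥0∞)) q.2) :=
      ((measurable_const.indicator hD).comp measurable_snd)
    have e : (fun q : ℝ × (Fin 2 → ℝ) => {v : Fin 2 → ℝ | v 0 ^ 2 + v 1 ^ 2 ≤ 2}.indicator (fun v => H (q.1, q.1 • v)) q.2) =
        fun q => {v : Fin 2 → ℝ | v 0 ^ 2 + v 1 ^ 2 ≤ 2}.indicator (fun _ => (1 : ℝ≥0∞)) q.2 * H (q.1, q.1 • q.2) := by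
      funext q
      by_cases hq : q.2 ∈ {v : Fin 2 → ℝ | v 0 ^ 2 + v 1 ^ 2 ≤ 2}
      · rw [Set.indicator_of_mem hq, Set.indicator_of_mem hq, one_mul]
      · rw [Set.indicator_of_notMem hq, Set.indicator_of_notMem hq, zero_mul]
    rw [e]
    exact h2.mul h1
  rw [lintegral_lintegral_swap hF.aemeasurable]
  -- (4) the radial rescaling at fixed `v`
  refine lintegral_congr fun v => ?_
  by_cases hv : v ∈ {v : Fin 2 → ℝ | v 0 ^ 2 + v 1 ^ 2 ≤ 2}
  · simp only [Set.indicator_of_mem hv]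
    set lam : ℝ := Real.sqrt (1 + (v 0 ^ 2 + v 1 ^ 2)) with hlam
    have hlam0 : 0 < lam := Real.sqrt_pos.2 (by positivity)
    have hg : Measurable fun x₀ : ℝ => ENNReal.ofReal (x₀ ^ 2) * H (x₀, x₀ • v) :=
      (ENNReal.measurable_ofReal.comp (measurable_id.pow_const 2)).mul (hH.comp (measurable_id.prodMk (measurable_id.smul measurable_const)))
    have hlam_ne : lam ≠ 0 := hlam0.ne'
    have hmeas : Measurable fun a : ℝ => ENNReal.ofReal ((lam⁻¹ * a) ^ 2) * H (lam⁻¹ * a, (lam⁻¹ * a) • v) :=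
      hg.comp (measurable_const_mul lam⁻¹)
    rw [lintegral_real_rescale hg hlam0, ← lintegral_const_mul _ hmeas]
    refine lintegral_congr fun a => ?_
    rw [← mul_assoc, ← ENNReal.ofReal_mul (by positivity), mul_comm]
    congr 2
    field_simp
  · simp only [Set.indicator_of_notMem hv, mul_zero, lintegral_const, zero_mul]

/-! ## §3 The three cones cover `ℝ³`; transfer to `ℝ × ℝ²` -/

/-- The three coordinate cones `K_i = {Σ_{j≠i} x_j² ≤ 2x_i²}` cover `ℝ³`. [folklore] -/
theorem cones_cover (x : Fin 3 → ℝ) :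
    x 1 ^ 2 + x 2 ^ 2 ≤ 2 * x 0 ^ 2 ∨ x 0 ^ 2 + x 2 ^ 2 ≤ 2 * x 1 ^ 2 ∨ x 0 ^ 2 + x 1 ^ 2 ≤ 2 * x 2 ^ 2 := by
  by_contra h
  push Not at h
  obtain ⟨h0, h1, h2⟩ := h
  nlinarith [sq_nonneg (x 0), sq_nonneg (x 1), sq_nonneg (x 2)]

/-- The cones are measurable. [folklore] -/
theorem measurableSet_cone (i j k : Fin 3) : MeasurableSet {x : Fin 3 → ℝ | x j ^ 2 + x k ^ 2 ≤ 2 * x i ^ 2} :=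
  measurableSet_le (((measurable_pi_apply j).pow_const 2).add ((measurable_pi_apply k).pow_const 2)) (((measurable_pi_apply i).pow_const 2).const_mul 2)

/-- ★ `∫⁻ H ≤ ∫⁻ 𝟙_{K₀}H + ∫⁻ 𝟙_{K₁}H + ∫⁻ 𝟙_{K₂}H` on `ℝ³` (any measure). [folklore] -/
theorem lintegral_le_cones (μ : Measure (Fin 3 → ℝ)) {H : (Fin 3 → ℝ) → ℝ≥0∞} (hH : Measurable H) :
    ∫⁻ x, H x ∂μ ≤
      ∫⁻ x, {x : Fin 3 → ℝ | x 1 ^ 2 + x 2 ^ 2 ≤ 2 * x 0 ^ 2}.indicator H x ∂μ +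
        ∫⁻ x, {x : Fin 3 → ℝ | x 0 ^ 2 + x 2 ^ 2 ≤ 2 * x 1 ^ 2}.indicator H x ∂μ +
        ∫⁻ x, {x : Fin 3 → ℝ | x 0 ^ 2 + x 1 ^ 2 ≤ 2 * x 2 ^ 2}.indicator H x ∂μ := by
  have hS0 := measurableSet_cone 0 1 2
  have hS1 := measurableSet_cone 1 0 2
  have hS2 := measurableSet_cone 2 0 1
  have hsplit1 := lintegral_add_left (μ := μ) ((hH.indicator hS0).add (hH.indicator hS1))
    ({x : Fin 3 → ℝ | x 0 ^ 2 + x 1 ^ 2 ≤ 2 * x 2 ^ 2}.indicator H)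
  have hsplit2 := lintegral_add_left (μ := μ) (hH.indicator hS0) ({x : Fin 3 → ℝ | x 0 ^ 2 + x 2 ^ 2 ≤ 2 * x 1 ^ 2}.indicator H)
  simp only [Pi.add_apply] at hsplit1 hsplit2
  rw [← hsplit2, ← hsplit1]
  refine lintegral_mono fun x => ?_
  rcases cones_cover x with h | h | h
  · rw [Set.indicator_of_mem (show x ∈ {x : Fin 3 → ℝ | x 1 ^ 2 + x 2 ^ 2 ≤ 2 * x 0 ^ 2} from h)]
    exact le_add_right (le_add_right le_rfl)
  · rw [Set.indicator_of_mem (show x ∈ {x : Fin 3 → ℝ | x 0 ^ 2 + x 2 ^ 2 ≤ 2 * x 1 ^ 2} from h)]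
    exact le_add_right (le_add_left le_rfl)
  · rw [Set.indicator_of_mem (show x ∈ {x : Fin 3 → ℝ | x 0 ^ 2 + x 1 ^ 2 ≤ 2 * x 2 ^ 2} from h)]
    exact le_add_left le_rfl

/-- ★ **TRANSFER OF A CONE TO `ℝ × ℝ²`** along `e_i = MeasurableEquiv.piFinSuccAbove (fun _ => ℝ) i` (`(e_i x).1 = x_i`, `(e_i x).2 j = x_{i.succAbove j}`):
`∫⁻ 𝟙_{K_i}(x) H(x) dx = ∫⁻ 𝟙_{|q.2|² ≤ 2 q.1²} H(e_i⁻¹ q) dq`. [folklore] -/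
theorem lintegral_cone_transfer (i : Fin 3) {H : (Fin 3 → ℝ) → ℝ≥0∞} (hH : Measurable H) :
    ∫⁻ x : Fin 3 → ℝ, {x : Fin 3 → ℝ | x (i.succAbove 0) ^ 2 + x (i.succAbove 1) ^ 2 ≤ 2 * x i ^ 2}.indicator H x =
      ∫⁻ q : ℝ × (Fin 2 → ℝ), {q : ℝ × (Fin 2 → ℝ) | q.2 0 ^ 2 + q.2 1 ^ 2 ≤ 2 * q.1 ^ 2}.indicator
        (fun q => H ((MeasurableEquiv.piFinSuccAbove (fun _ => ℝ) i).symm q)) q := by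
  set e := MeasurableEquiv.piFinSuccAbove (fun _ : Fin 3 => ℝ) i with he
  have hT : MeasurePreserving e volume volume := volume_preserving_piFinSuccAbove (fun _ : Fin 3 => ℝ) i
  have hK : MeasurableSet {q : ℝ × (Fin 2 → ℝ) | q.2 0 ^ 2 + q.2 1 ^ 2 ≤ 2 * q.1 ^ 2} :=
    measurableSet_le ((((measurable_pi_apply 0).comp measurable_snd).pow_const 2).add (((measurable_pi_apply 1).comp measurable_snd).pow_const 2))
      ((measurable_fst.pow_const 2).const_mul 2)
  have hG : Measurable fun q : ℝ × (Fin 2 → ℝ) => {q : ℝ × (Fin 2 → ℝ) | q.2 0 ^ 2 + q.2 1 ^ 2 ≤ 2 * q.1 ^ 2}.indicator (fun q => H (e.symm q)) q :=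
    (hH.comp e.symm.measurable).indicator hK
  rw [← hT.lintegral_comp hG]
  refine lintegral_congr fun x => ?_
  have h1 : (e x).1 = x i := rfl
  have h2 : ∀ j : Fin 2, (e x).2 j = x (i.succAbove j) := fun j => rfl
  have hsymm : e.symm (e x) = x := e.symm_apply_apply x
  by_cases hx : x (i.succAbove 0) ^ 2 + x (i.succAbove 1) ^ 2 ≤ 2 * x i ^ 2
  · have hq : e x ∈ {q : ℝ × (Fin 2 → ℝ) | q.2 0 ^ 2 + q.2 1 ^ 2 ≤ 2 * q.1 ^ 2} := by
      show (e x).2 0 ^ 2 + (e x).2 1 ^ 2 ≤ 2 * (e x).1 ^ 2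
      rw [h1, h2, h2]; exact hx
    rw [Set.indicator_of_mem (show x ∈ {x : Fin 3 → ℝ | x (i.succAbove 0) ^ 2 + x (i.succAbove 1) ^ 2 ≤ 2 * x i ^ 2} from hx), Set.indicator_of_mem hq, hsymm]
  · have hq : e x ∉ {q : ℝ × (Fin 2 → ℝ) | q.2 0 ^ 2 + q.2 1 ^ 2 ≤ 2 * q.1 ^ 2} := fun h => by
      have h' : (e x).2 0 ^ 2 + (e x).2 1 ^ 2 ≤ 2 * (e x).1 ^ 2 := h
      rw [h1, h2, h2] at h'; exact hx h'
    rw [Set.indicator_of_notMem (show x ∉ {x : Fin 3 → ℝ | x (i.succAbove 0) ^ 2 + x (i.succAbove 1) ^ 2 ≤ 2 * x i ^ 2} from hx),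
      Set.indicator_of_notMem hq]


/-- ★★ **THE THREE-CONE REDUCTION OF AN `ℝ³`-INTEGRAL TO `ℝ × ℝ²`**: for measurable `H ≥ 0` (volume),
`∫⁻ H ≤ Σ_{i=0,1,2} ∫⁻ q, 𝟙_{|q.2|² ≤ 2q.1²} H(e_i⁻¹ q) dq` — then ✓`lintegral_cone_subst` applies to each term. [folklore] -/
theorem lintegral_le_cones_transfer {H : (Fin 3 → ℝ) → ℝ≥0∞} (hH : Measurable H) :
    ∫⁻ x : Fin 3 → ℝ, H x ≤
      (∫⁻ q : ℝ × (Fin 2 → ℝ), {q : ℝ × (Fin 2 → ℝ) | q.2 0 ^ 2 + q.2 1 ^ 2 ≤ 2 * q.1 ^ 2}.indicator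
          (fun q => H ((MeasurableEquiv.piFinSuccAbove (fun _ => ℝ) 0).symm q)) q) +
        (∫⁻ q : ℝ × (Fin 2 → ℝ), {q : ℝ × (Fin 2 → ℝ) | q.2 0 ^ 2 + q.2 1 ^ 2 ≤ 2 * q.1 ^ 2}.indicator
          (fun q => H ((MeasurableEquiv.piFinSuccAbove (fun _ => ℝ) 1).symm q)) q) +
        (∫⁻ q : ℝ × (Fin 2 → ℝ), {q : ℝ × (Fin 2 → ℝ) | q.2 0 ^ 2 + q.2 1 ^ 2 ≤ 2 * q.1 ^ 2}.indicator
          (fun q => H ((MeasurableEquiv.piFinSuccAbove (fun _ => ℝ) 2).symm q)) q) := by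
  have h0 := lintegral_cone_transfer 0 hH
  have h1 := lintegral_cone_transfer 1 hH
  have h2 := lintegral_cone_transfer 2 hH
  have e0 : ∫⁻ x : Fin 3 → ℝ, {x : Fin 3 → ℝ | x 1 ^ 2 + x 2 ^ 2 ≤ 2 * x 0 ^ 2}.indicator H x =
      ∫⁻ x : Fin 3 → ℝ, {x : Fin 3 → ℝ | x ((0 : Fin 3).succAbove 0) ^ 2 + x ((0 : Fin 3).succAbove 1) ^ 2 ≤ 2 * x 0 ^ 2}.indicator H x := rfl
  have e1 : ∫⁻ x : Fin 3 → ℝ, {x : Fin 3 → ℝ | x 0 ^ 2 + x 2 ^ 2 ≤ 2 * x 1 ^ 2}.indicator H x =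
      ∫⁻ x : Fin 3 → ℝ, {x : Fin 3 → ℝ | x ((1 : Fin 3).succAbove 0) ^ 2 + x ((1 : Fin 3).succAbove 1) ^ 2 ≤ 2 * x 1 ^ 2}.indicator H x := rfl
  have e2 : ∫⁻ x : Fin 3 → ℝ, {x : Fin 3 → ℝ | x 0 ^ 2 + x 1 ^ 2 ≤ 2 * x 2 ^ 2}.indicator H x =
      ∫⁻ x : Fin 3 → ℝ, {x : Fin 3 → ℝ | x ((2 : Fin 3).succAbove 0) ^ 2 + x ((2 : Fin 3).succAbove 1) ^ 2 ≤ 2 * x 2 ^ 2}.indicator H x := rfl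
  have h := lintegral_le_cones volume hH
  rw [e0, e1, e2, h0, h1, h2] at h
  exact h

end Summit.QuantumFields.YangMills.Theorems.SwapVirialDeficit.SectorLaplace

end
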